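import Summits.BirchSwinnertonDyer.BirchSwinnertonDyer.Theorems.ByReductionTypeAtTwoMultKatoRatOfInputsTwo
import Summits.BirchSwinnertonDyer.BirchSwinnertonDyer.Theorems.ByReductionTypeAtTwoMultUpperHalfTowerNonsplit
import Literature.NumberTheory.EllipticCurves.Kato2004.DivisibilityInputsMultiplicativeDescent
import HarnessLib

/-!
# K11a in the KERNEL modulo PRINT-located inputs only: Kato's `⊗ℚ` divisibility at a NON-SPLIT
# multiplicative `2` from `nonempty_iwasawaH1Data`, `thm12_4`, Greenberg's Thm. 1.5 and the Literature
# construction fact `Kato2004.exists_multDivisibilityInputsDescent_nonsplit` (no `p ≠ 2` binder)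

Cell `bsd-2adic` (run/shared/lean/pub/bsd-2adic/), seat `bsd-2adic-mult` GEN 10; HUMAN RULINGS D-0036 /
D-0054; director (Q2) 2026-08-26 «make it a KERNEL theorem». HONEST FRAMING: research route; nothing
is asserted; no class is closed here; no count moves. PARTITION: X5@2 multiplicative NON-SPLIT (K4ᵐ,
RESIDUAL-MAP B1·O1; 1 273 of the 1 976 book230 multiplicative classes) × p = 2 — types-the-object-of;
bears_on K4 items 19922 / 19923 (binder `hKato`/K11a of the 489 non-split MultTowerClass rows, the
non-split t42 rows, the S3 converse twins).

GEN 9 (`ByReductionTypeAtTwoMultKatoRatOfInputsTwo.lean`) derived the cell's prime-2 binder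
`X5.O1.KatoMultiplicativeDivisibilityRat W 2` from the two Summits-side `@[conjecture]` package
constants `MultKatoInputs.exists_multDivisibilityInputs_{nonsplit,split}_two`, each with ONE unprinted
field (audit sheet HOME/audit/D-AUDIT-K11inputs-Kato-mult-package-at-2.md: at a non-split `2` exactly
`col_injective` — Prop. 17.11 read on the `ℤ₂`-tower). GEN 10 replaces, on the NON-SPLIT side, that
constant by the Literature construction fact `Kato2004.exists_multDivisibilityInputsDescent_nonsplit`
(file `Kato2004/DivisibilityInputsMultiplicativeDescent`): the same package with the Coleman clause
presented over Kato's own tower `ℚ₂(ζ_{2^∞})` by its printed ingredients (Lemma 17.12 VERBATIM at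
`T″(k−1) = ℤ₂(φ)`, the two opening sentences of the proof of Prop. 17.11, `Λ_G`-linearity of `𝔏_η`,
the `Δ = {±1}`-descent data of Kato 12.1) — Prop. 17.11's two-line proof, the `Δ`-descent (kernel
killed by `2`) and §17.13 with a Coleman map injective up to `2`-torsion being PROVED module theory
(`KatoDivisibilityColemanKernelSkeletonProofs`, p483167). OUTPUT:
* `katoDivisibilityAtTwoNonsplitMultRat_of_descent` — **K11a (`X5.O1.KatoDivisibilityAtTwoNonsplitMultRat
  W f L`, every `W`, `f`, `L`) from {`hne`, `h12`, `hdesc`, `h15`}: kernel ∘ {two accepted Kato facts,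
  ONE Literature construction fact with print-located fields, Greenberg Thm. 1.5 (PRINT)}** — no
  Summits `@[conjecture]`, no memo binder;
* `katoMultiplicativeDivisibilityRat_two_of_descent_nonsplit` — the prime-uniform binder
  `X5.O1.KatoMultiplicativeDivisibilityRat W 2` at a NON-SPLIT `W` from the same four inputs;
* `katoMultiplicativeDivisibilityRat_two_of_descent_of_split_inputs` /
  `katoRatAtMultTwo_of_descent_of_split_inputs` / `…_forall_…` — both signs: the non-split package from
  the Literature fact, the split package still from the Summits constant
  `exists_multDivisibilityInputs_split_two` (Kobayashi 2006 Thm. 4.1 at `2`: memo PROOF-KATO2SPLIT; NOT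
  touched here) — i.e. GEN 9's `katoRatAtMultTwo_of_inputs` with `hns` replaced by `hdesc`.
HOW TO USE: wherever a door / class file binds `hKato : ∀ W, ¬ W.HasCM → Mult W 2 →
O1.KatoMultiplicativeDivisibilityRat W 2`, feed `katoMultiplicativeDivisibilityRat_forall_two_of_descent_of_split_inputs
hne h12 hdesc hsp h15`; on a NON-SPLIT row needing only K11a, feed
`katoDivisibilityAtTwoNonsplitMultRat_of_descent W hne h12 hdesc h15 f L` (displayed binders: two
accepted Kato facts + `Kato2004.exists_multDivisibilityInputsDescent_nonsplit` + h15). WHAT THIS IS NOT: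
not Prop. 17.11 on the `ℤ₂`-tower; not the split clause; not the integral clause 12.5 (4) / 17.4 (3);
no `μ`; no class closes; nothing is booked; BSD is not advanced.

References: [Kato2004Asterisque] 12.1, Thm. 12.4–12.6, §16, Prop. 17.11 / Lemma 17.12, §17.13;
[GreenbergLNM1716] Thm. 1.5, §2; [Silverman1994] Thm. V.5.3; cell memos HOME/mult/KERNEL-K11-INPUTS.md,
KERNEL-K11-COLEMAN-DESCENT.md.
-/

set_option autoImplicit false
-- the Theorems namespace of this sub repeats the summit name by design (D-0017 nested layout: Summit.<S>.<Sub>)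
set_option linter.dupNamespace false

noncomputable section

open scoped Classical MatrixGroups ModularForm

open NumberField IsDedekindDomain CongruenceSubgroup WeierstrassCurve Literature.NumberTheory.EllipticCurves
  Literature.NumberTheory.EllipticCurves.ModularForms
  Literature.NumberTheory.EllipticCurves.Rank1Residual
  Literature.NumberTheory.EllipticCurves.Rank1Residual.Typed
  Literature.NumberTheory.EllipticCurves.Greenberg1999
  Summit.BirchSwinnertonDyer.Rank1Residual
  Summit.BirchSwinnertonDyer.BirchSwinnertonDyer.Theorems.MultKatoInputs

namespace Summit.BirchSwinnertonDyer.BirchSwinnertonDyer.Theorems.MultKatoRat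

variable (W : WeierstrassCurve ℚ) [W.IsElliptic] [W.IsGloballyMinimal]

/-- **K11a at `p = 2` — kernel modulo located inputs, NO Summits conjecture constant.** For every
globally minimal elliptic `W/ℚ`, every newform `f` and every `L`:
`X5.O1.KatoDivisibilityAtTwoNonsplitMultRat W f L` (for the cyclotomic `κ`, `γ`, `W` multiplicative
NON-split at `2`, `f` the newform of `W`, `L` the MTT function: `X(E/ℚ_∞)` torsion and `ι g = 2ⁿ·L`,
`g ∈ char_Λ X`) follows from `Kato2004.nonempty_iwasawaH1Data`, `Kato2004.thm12_4` (accepted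
construction / statement facts, any prime), the construction fact
`Kato2004.exists_multDivisibilityInputsDescent_nonsplit` (Kato §§12–17 over `ℚ₂(ζ_{2^∞})` with Lemma
17.12 verbatim at `ℤ₂(φ)`, descended; every field print-located) and Greenberg's Thm. 1.5
(`thm15_isTorsion_multiplicative_rat`, torsion for `L = 0` as well) — the divisibility for `L ≠ 0` by
`Kato2004.katoDivisibility_nonsplitMult_of_descentFacts` (PROVED module theory with the descended
Coleman map injective up to `2`-torsion), for `L = 0` with `g = 0`; the `ℤ₂`-continuity instance of
`T₂W` is `TateModule.continuousSMul_padicInt`.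
[cite: Kato2004Asterisque, Thm. 17.4 (1)(2) (p. 273; shape), Prop. 17.11 / Lemma 17.12 (pp. 277–279), §17.13 (pp. 279–280)]
[cite: GreenbergLNM1716, Thm. 1.5 (PDF p. 61)] -/
theorem katoDivisibilityAtTwoNonsplitMultRat_of_descent (hne : Kato2004.nonempty_iwasawaH1Data)
    (h12 : Kato2004.thm12_4) (hdesc : Kato2004.exists_multDivisibilityInputsDescent_nonsplit)
    (h15 : thm15_isTorsion_multiplicative_rat) {N : ℕ} [NeZero N] (f : CuspForm (Gamma0 N) 2)
    (L : PowerSeries ℚ_[2]) : X5.O1.KatoDivisibilityAtTwoNonsplitMultRat W f L := by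
  haveI : ContinuousSMul ℤ_[2] (W.tateModule 2) := TateModule.continuousSMul_padicInt
  intro κ γ hκ hγ hγ' hmult hns hf hL D
  refine ⟨h15 W 2 hmult f hf κ γ hκ hγ D, ?_⟩
  by_cases hL0 : L = 0
  · exact ⟨0, 0, Submodule.zero_mem _, by simp [hL0]⟩
  · obtain ⟨-, n, g, hg, hι⟩ := Kato2004.katoDivisibility_nonsplitMult_of_descentFacts hne h12 hdesc
      hmult hns hκ hγ hγ' hf hL hL0 D
    refine ⟨n, g, hg, ?_⟩
    rw [hι, Nat.cast_ofNat]

/-- **The prime-uniform binder `X5.O1.KatoMultiplicativeDivisibilityRat W 2` at a NON-SPLIT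
multiplicative `2`, from the located inputs** (no Summits conjecture constant): the split clause of the
binder is vacuous for such `W`. [cite: Kato2004Asterisque, Thm. 17.4 (1)(2) (p. 273; shape) and §17.13 (pp. 279–280)]
[cite: GreenbergLNM1716, Thm. 1.5 (PDF p. 61)] -/
theorem katoMultiplicativeDivisibilityRat_two_of_descent_nonsplit
    (hnsW : ¬ W.HasSplitMultiplicativeReductionAtPrime 2)
    (hne : Kato2004.nonempty_iwasawaH1Data) (h12 : Kato2004.thm12_4)
    (hdesc : Kato2004.exists_multDivisibilityInputsDescent_nonsplit)
    (h15 : thm15_isTorsion_multiplicative_rat) : X5.O1.KatoMultiplicativeDivisibilityRat W 2 := by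
  haveI : ContinuousSMul ℤ_[2] (W.tateModule 2) := TateModule.continuousSMul_padicInt
  intro κ γ hκ hγ hγ' hmult N _ f hf D
  refine ⟨h15 W 2 hmult f hf κ γ hκ hγ D, fun hns L hL => ?_, fun hsp => absurd hsp hnsW⟩
  by_cases hL0 : L = 0
  · exact ⟨0, 0, Submodule.zero_mem _, by simp [hL0]⟩
  · obtain ⟨-, n, g, hg, hι⟩ := Kato2004.katoDivisibility_nonsplitMult_of_descentFacts hne h12 hdesc
      hmult hns hκ hγ hγ' hf hL hL0 D
    exact ⟨n, g, hg, hι⟩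

/-- **Both signs: `X5.O1.KatoMultiplicativeDivisibilityRat W 2` from the located inputs, the NON-SPLIT
package from the Literature fact and the SPLIT package from the Summits constant
`exists_multDivisibilityInputs_split_two`** (= GEN 9's `katoMultiplicativeDivisibilityRat_two_of_inputs`
with `hns ↦ hdesc`; the split half stays memo-grade: Kobayashi 2006 Thm. 4.1 at `2`).
[cite: Kato2004Asterisque, Thm. 17.4 (1)(2) (p. 273; shape), Thm. 12.5 (3) (p. 222), §17.13 (pp. 279–280)]
[cite: Kobayashi2006DocMath, Thm. 4.1 (split; odd p in print)] -/
theorem katoMultiplicativeDivisibilityRat_two_of_descent_of_split_inputs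
    (hne : Kato2004.nonempty_iwasawaH1Data) (h12 : Kato2004.thm12_4)
    (hdesc : Kato2004.exists_multDivisibilityInputsDescent_nonsplit)
    (hsp : exists_multDivisibilityInputs_split_two) (h15 : thm15_isTorsion_multiplicative_rat) :
    X5.O1.KatoMultiplicativeDivisibilityRat W 2 := by
  by_cases hspW : W.HasSplitMultiplicativeReductionAtPrime 2
  · exact katoMultiplicativeDivisibilityRat_of_packages W 2 hne h12 h15
      (fun f κ γ _ hn _ _ _ _ _ _ _ _ => absurd hspW hn)
      (fun f κ γ hs hκ hγ hγ' hf L hL I D => hsp W f κ γ hs hκ hγ hγ' hf L hL I D)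
  · exact katoMultiplicativeDivisibilityRat_two_of_descent_nonsplit W hspW hne h12 hdesc h15

/-- **The universal `hKato` binder of the mult lane's class files at `2`, from the located inputs**
(`hns ↦ hdesc` in GEN 9's `katoMultiplicativeDivisibilityRat_forall_two_of_inputs`).
[cite: Kato2004Asterisque, Thm. 17.4 (1)(2) (p. 273; shape) and §17.13 (pp. 279–280)] -/
theorem katoMultiplicativeDivisibilityRat_forall_two_of_descent_of_split_inputs
    (hne : Kato2004.nonempty_iwasawaH1Data) (h12 : Kato2004.thm12_4)
    (hdesc : Kato2004.exists_multDivisibilityInputsDescent_nonsplit)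
    (hsp : exists_multDivisibilityInputs_split_two) (h15 : thm15_isTorsion_multiplicative_rat) :
    ∀ (V : WeierstrassCurve ℚ) [V.IsElliptic] [V.IsGloballyMinimal],
      ¬ V.HasCM → Mult V 2 → X5.O1.KatoMultiplicativeDivisibilityRat V 2 :=
  fun V _ _ _ _ => katoMultiplicativeDivisibilityRat_two_of_descent_of_split_inputs V hne h12 hdesc hsp h15

/-- **`stub_katoRat` of crux 19922 (line `four_roads`) modulo the located inputs** — the registered stub
constant `MultUpperHalvesAtTwo.KatoRatAtMultTwo` from `nonempty_iwasawaH1Data`, `thm12_4`, the Literature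
fact `exists_multDivisibilityInputsDescent_nonsplit` (non-split half, print-located), the Summits constant
`exists_multDivisibilityInputs_split_two` (split half, memo) and Greenberg's Thm. 1.5 (NOT a proof of the
stub: its inputs stay displayed; the non-split half no longer displays a Summits conjecture).
[cite: Kato2004Asterisque, Thm. 17.4 (1)(2) (p. 273; shape) and §17.13 (pp. 279–280)] -/
theorem katoRatAtMultTwo_of_descent_of_split_inputs (hne : Kato2004.nonempty_iwasawaH1Data)
    (h12 : Kato2004.thm12_4) (hdesc : Kato2004.exists_multDivisibilityInputsDescent_nonsplit)
    (hsp : exists_multDivisibilityInputs_split_two) (h15 : thm15_isTorsion_multiplicative_rat) :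
    MultUpperHalvesAtTwo.KatoRatAtMultTwo :=
  fun V _ _ _ _ => katoMultiplicativeDivisibilityRat_two_of_descent_of_split_inputs V hne h12 hdesc hsp h15

/-- **The GEN 9 non-split constant is IMPLIED on its `⊗ℚ` consequence**: every consumer of
`exists_multDivisibilityInputs_nonsplit_two` through `katoDivisibilityAtTwoNonsplitMultRat_of_inputs`
can be re-keyed on `hdesc` — recorded as the pair of projections agreeing on K11a. Bookkeeping.
[cite: Kato2004Asterisque, Thm. 17.4 (1)(2) (p. 273; shape)] -/
theorem katoDivisibilityAtTwoNonsplitMultRat_of_descent_or_inputs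
    (hne : Kato2004.nonempty_iwasawaH1Data) (h12 : Kato2004.thm12_4)
    (h : Kato2004.exists_multDivisibilityInputsDescent_nonsplit ∨
      (exists_multDivisibilityInputs_nonsplit_two ∧ exists_multDivisibilityInputs_split_two))
    (h15 : thm15_isTorsion_multiplicative_rat) {N : ℕ} [NeZero N] (f : CuspForm (Gamma0 N) 2)
    (L : PowerSeries ℚ_[2]) : X5.O1.KatoDivisibilityAtTwoNonsplitMultRat W f L := by
  rcases h with hdesc | ⟨hns, hsp⟩
  · exact katoDivisibilityAtTwoNonsplitMultRat_of_descent W hne h12 hdesc h15 f L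
  · exact katoDivisibilityAtTwoNonsplitMultRat_of_inputs W hne h12 hns hsp h15 f L

/-! ## The non-split TOWER door (item 19922 per class) with neither `hGS` nor a Summits conjecture -/

/-- **TOWER road at a NON-SPLIT multiplicative `2`, per class, GS-free AND conjecture-free**: mult-2's
per-member socket `missingUpperBoundAt_two_nonsplit_of_towerGapMember_of_katoRatAt` (file
`ByReductionTypeAtTwoMultUpperHalfTowerNonsplit`, p470568) with `hKato₁ : O1.KatoMultiplicativeDivisibilityRat
W₁ 2` SUPPLIED at the certified non-split member `W₁` by
`katoMultiplicativeDivisibilityRat_two_of_descent_nonsplit`. Displayed: KATO FACTS {`hne`, `h12`}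
(accepted) + the Literature construction fact `hdesc` + PRINT {`h15`, `h41ns'`, `h41sp`, `hmod`, `hGZK`,
`hCassels`, `hC`} + the member data {`hiso`, `hns₁`, `hgap` (tower-gap certificate), `hB`}. For the 489
non-split MultTowerClass rows: the binder `hns : MultKatoInputs.exists_multDivisibilityInputs_nonsplit_two`
(Summits `@[conjecture]`) is no longer needed. Not a booking.
[cite: Kato2004Asterisque, Thm. 17.4 (1)(2) (p. 273; shape) and §17.13 (pp. 279–280)]
[cite: GreenbergLNM1716, Thm. 1.5 and §4 pp. 112–113] [cite: Miller2011LMS, Def. 1.1] -/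
theorem missingUpperBoundAt_two_nonsplit_of_towerGapMember_of_descent
    (hne : Kato2004.nonempty_iwasawaH1Data) (h12 : Kato2004.thm12_4)
    (hdesc : Kato2004.exists_multDivisibilityInputsDescent_nonsplit)
    (h15 : thm15_isTorsion_multiplicative_rat)
    (h41ns' : thm41Analogue_charValue_rankZero_numberField_anyPrime_oddLocalDegree)
    (h41sp : thm41Analogue_charValue_rankZero_split_baseChange_anyPrime)
    (hmod : nonempty_modularParametrizationData)
    (hGZK : rank_eq_analyticRank_of_analyticRank_le_one)
    (hCassels : bsdRHS_eq_of_isIsogenous)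
    (hC : cesnavicius_not_two_dvd_maninConstant_of_two_dvd_level)
    (V : WeierstrassCurve ℚ) [V.IsElliptic] [V.IsGloballyMinimal]
    (hr : V.analyticRank = 0) (hmult : Mult V 2)
    (W₁ : WeierstrassCurve ℚ) [W₁.IsElliptic] [W₁.IsGloballyMinimal] (hiso : IsIsogenous V W₁)
    (hns₁ : ¬ W₁.HasSplitMultiplicativeReductionAtPrime 2)
    (hgap : X5.O1.TowerGapAtTwo W₁)
    (hB : Irr W₁ 2 ∨
      (∀ [NeZero (W₁.conductorNorm ℤ)],
        ∃ D : ModularParametrizationData W₁ (W₁.conductorNorm ℤ), Zhai2021.IsOptimalDatum W₁ D) ∨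
      (∀ [NeZero (W₁.conductorNorm ℤ)] (f : CuspForm (Gamma0 (W₁.conductorNorm ℤ)) 2),
        IsNewformOf W₁ f → ∀ ϖ : ℚ, (ϖ : ℝ) * W₁.realPeriodRat = plusPeriod f →
          0 ≤ padicValRat 2 ϖ)) :
    MissingUpperBoundAt V 2 :=
  Summit.BirchSwinnertonDyer.BirchSwinnertonDyer.Theorems.missingUpperBoundAt_two_nonsplit_of_towerGapMember_of_katoRatAt
    h41ns' h41sp hmod hGZK hCassels hC V hr hmult W₁ hiso
    (katoMultiplicativeDivisibilityRat_two_of_descent_nonsplit W₁ hns₁ hne h12 hdesc h15) hns₁ hgap hB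

end Summit.BirchSwinnertonDyer.BirchSwinnertonDyer.Theorems.MultKatoRat

end
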